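import Literature.Analysis.FluidPDE.ForwardDSSLocalLerayProofs
import Literature.Analysis.FluidPDE.PeriodicLeraySystemProofs
import Literature.Analysis.FluidPDE.PeriodicLerayExistenceProofs
import Literature.Analysis.FluidPDE.PeriodicLerayProfileGradient
import Literature.Analysis.FluidPDE.PeriodicLerayExistenceLimitProofs
import HarnessLib

/-!
# [BT1] Theorem 1.2 reduced to its last undischarged ingredient (the mollified approximants)

Analysis/FluidPDE proof file (theorems only, no definitions, no named facts), sibling of
`ForwardDSSExistence.lean`, whose named fact
`Literature.Analysis.FluidPDE.bradshawTsai2017_dss_localLeray_existence` renders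

> **Bradshaw–Tsai, Ann. Henri Poincaré 18 (2017) = arXiv:1510.07504 [BT1], Theorem 1.2.** Let
> `v₀` be a divergence free, `λ`-DSS vector field for some `λ > 1` and satisfy
> `‖v₀‖_{L³_w(ℝ³)} ≤ c₀` for a possibly large constant `c₀`. Then, there exists a local Leray
> solution `v` to (NSE) which is `λ`-DSS [and `‖v(t) − e^{tΔ}v₀‖_{L²(ℝ³)} ≤ C₀ t^{1/4}`, omitted].

The printed proof has been vendored in the tree as a DAG of named facts with proved assemblies,
and every leaf of that DAG except one has since been discharged:

* `bradshawTsai2017_dss_localLeray_existence_of_parts` (`ForwardDSSLocalLeray`): Thm 2.4 (with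
  Lemma 3.4, in the physical variables: `bradshawTsai2017_thm_2_4`) + §4
  (`bradshawTsai2017_section4`, **discharged**: `bradshawTsai2017_section4_holds`,
  `ForwardDSSLocalLerayProofs`);
* `bradshawTsai2017_thm_2_4_of_parts` (`PeriodicLeraySystem`): Lemma 3.4
  (**discharged**: `bradshawTsai2017_lemma_3_4_holds`) + Thm 2.4 in the similarity variables
  (`bradshawTsai2017_thm_2_4_periodic`) + §4 ¶1–3, the ansatz (**discharged**:
  `bradshawTsai2017_ansatz_transport_holds`; both in `PeriodicLeraySystemProofs`);
* `bradshawTsai2017_thm_2_4_periodic_of_parts` (`PeriodicLerayExistence`): Lemma 2.5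
  (**discharged**: `bradshawTsai2017_lemma_2_5_holds`, `PeriodicLerayExistenceProofs`) + the
  gradient bound of its proof (**discharged**: `bradshawTsai2017_lemma_2_5_gradient_holds`,
  `PeriodicLerayProfileGradient`) + **Lemma 2.6 with the first part of the proof of Thm 2.4, the
  mollified approximants (`bradshawTsai2017_thm_2_4_mollified`, NOT discharged)** + the limit
  `ε → 0` (**discharged**: `bradshawTsai2017_thm_2_4_limit_holds`,
  `PeriodicLerayExistenceLimitProofs`).

This file composes the three assemblies with the six discharges: **[BT1] Thm 2.4 (periodic
form), Thm 2.4 (physical form) and Thm 1.2 each follow from the single named fact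
`bradshawTsai2017_thm_2_4_mollified`** — the Galerkin construction of `T`-periodic weak
solutions `U_ε` of the mollified perturbed Leray system with the Riesz-transform pressure `p_ε`,
`‖p_ε‖_{L^{5/3}(ℝ³ × [0,T])} ≤ C` (Lemma 2.6 and the proof of Thm 2.4 up to "The limit `U_ε` is a
periodic weak solution of the mollified perturbed Leray system"). The trust base of
`bradshawTsai2017_dss_localLeray_existence` in the tree is thereby exactly
`{bradshawTsai2017_thm_2_4_mollified}`, and its discharge, once
`bradshawTsai2017_thm_2_4_mollified_holds` lands, is the one-liner
`bradshawTsai2017_dss_localLeray_existence_of_mollified bradshawTsai2017_thm_2_4_mollified_holds`.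

Nothing is restated: the file only imports the accepted fact/assembly/proof files listed above.

## References

* Z. Bradshaw, T.-P. Tsai, *Forward discretely self-similar solutions of the Navier–Stokes
  equations II*, Ann. Henri Poincaré 18 (2017) 1095–1119 = arXiv:1510.07504: §1 (Def. 1.1,
  Thm 1.2), §2 (Thm 2.4, Lemmas 2.5–2.6, proof of Thm 2.4), §3 (Lemma 3.4), §4 (proof of
  Thm 1.2) [BradshawTsai2017AHP].
-/

noncomputable section

namespace Literature.Analysis.FluidPDE

/-- **[BT1] Theorem 2.4 (suitable periodic weak solutions of the Leray system) from the mollified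
approximants alone**: the assembly `bradshawTsai2017_thm_2_4_periodic_of_parts` fed with the
discharged Lemma 2.5, its gradient bound and the limit `ε → 0`; the remaining hypothesis is
Lemma 2.6 with the first part of the proof of Thm 2.4 (`bradshawTsai2017_thm_2_4_mollified`). [cite: BradshawTsai2017AHP, Thm 2.4 and its proof] -/
theorem bradshawTsai2017_thm_2_4_periodic_of_mollified (hmol : bradshawTsai2017_thm_2_4_mollified) :
    bradshawTsai2017_thm_2_4_periodic :=
  bradshawTsai2017_thm_2_4_periodic_of_parts bradshawTsai2017_lemma_2_5_holds
    bradshawTsai2017_lemma_2_5_gradient_holds hmol bradshawTsai2017_thm_2_4_limit_holds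

/-- **[BT1] Theorem 2.4 with Lemma 3.4 in the physical variables (`bradshawTsai2017_thm_2_4`)
from the mollified approximants alone**: `bradshawTsai2017_thm_2_4_of_parts` fed with the
discharged Lemma 3.4, the ansatz transport of §4 ¶1–3, and Theorem 2.4 in the form
`bradshawTsai2017_thm_2_4_periodic_of_mollified`. [cite: BradshawTsai2017AHP, Thm 2.4 with Lemma 3.4 and §4 ¶1–3] -/
theorem bradshawTsai2017_thm_2_4_of_mollified (hmol : bradshawTsai2017_thm_2_4_mollified) :
    bradshawTsai2017_thm_2_4 :=
  bradshawTsai2017_thm_2_4_of_parts bradshawTsai2017_lemma_3_4_holds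
    (bradshawTsai2017_thm_2_4_periodic_of_mollified hmol) bradshawTsai2017_ansatz_transport_holds

/-- **[BT1] Theorem 1.2 (forward DSS local Leray solutions for divergence free `λ`-DSS data in
`L³_w`, `λ > 1`) from the mollified approximants alone**: the assembly
`bradshawTsai2017_dss_localLeray_existence_of_parts` (Thm 2.4 + §4) fed with
`bradshawTsai2017_thm_2_4_of_mollified` and the discharged §4 (`bradshawTsai2017_section4_holds`).
Hence the trust base of `bradshawTsai2017_dss_localLeray_existence` is
`{bradshawTsai2017_thm_2_4_mollified}`. [cite: BradshawTsai2017AHP, Thm 1.2] -/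
theorem bradshawTsai2017_dss_localLeray_existence_of_mollified
    (hmol : bradshawTsai2017_thm_2_4_mollified) : bradshawTsai2017_dss_localLeray_existence :=
  bradshawTsai2017_dss_localLeray_existence_of_parts (bradshawTsai2017_thm_2_4_of_mollified hmol)
    bradshawTsai2017_section4_holds

/-- **[BT1] Theorem 1.2 with its `t^{1/4}`-estimate, from the mollified approximants alone**: under
`bradshawTsai2017_thm_2_4_mollified`, every divergence free `λ`-DSS `v₀ ∈ L³_w(ℝ³)` (`λ > 1`) has a
`λ`-DSS local Leray solution `(v, π)` with `‖v(t) − e^{tΔ}v₀‖²_{L²(ℝ³)} ≤ C √t` for all `t > 0`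
(`bradshawTsai2017_thm_1_2_of_thm_2_4` with `bradshawTsai2017_thm_2_4_of_mollified`). [cite: BradshawTsai2017AHP, Thm 1.2] -/
theorem bradshawTsai2017_thm_1_2_of_mollified (hmol : bradshawTsai2017_thm_2_4_mollified) {c : ℝ}
    (hc : 1 < c) {v₀ : EuclideanSpace ℝ (Fin 3) → EuclideanSpace ℝ (Fin 3)}
    (hw : FunctionSpaces.MemWeakLp v₀ 3 MeasureTheory.volume) (hdiv : FluidPDE.IsWeaklyDivFree v₀)
    (hdss : FluidPDE.nsRescaleData c v₀ = v₀) :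
    ∃ (v : ℝ → EuclideanSpace ℝ (Fin 3) → EuclideanSpace ℝ (Fin 3))
      (π : ℝ → EuclideanSpace ℝ (Fin 3) → ℝ), IsLocalLeraySolution 1 v₀ v π ∧
      FluidPDE.IsDiscretelySelfSimilar c v ∧
      ∃ C : NNReal, ∀ t : ℝ, 0 < t →
        ∫⁻ x, ‖v t x - UnboundedOperators.heatExtension v₀ t x‖ₑ ^ 2 ≤
          C * ENNReal.ofReal (Real.sqrt t) :=
  bradshawTsai2017_thm_1_2_of_thm_2_4 (bradshawTsai2017_thm_2_4_of_mollified hmol) hc hw hdiv hdss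

end Literature.Analysis.FluidPDE

end
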